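import Mathlib.LinearAlgebra.Matrix.Trace
import Mathlib.LinearAlgebra.FiniteDimensional.Lemmas
import Mathlib.LinearAlgebra.Basis.VectorSpace
import Mathlib.LinearAlgebra.Dimension.Finrank
import Mathlib.Data.Matrix.Basic
import Mathlib.LinearAlgebra.Matrix.Notation
import Mathlib.Tactic.Module
import Mathlib.Tactic.LinearCombination
import Mathlib.Tactic.FieldSimp
import Mathlib.Tactic.FinCases
import HarnessLib

/-!
# Lie subalgebras of `𝔰𝔩₂` defined over a subfield: the trichotomy behind "`Hg(E) = SL₂`"

For an elliptic curve (weight-one Hodge structure of rank 2) `X` with `End⁰(X) = ℚ`, the Hodge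
group is all of `Sp(V, φ) = SL₂` (Moonen–Zarhin, *Hodge classes on abelian varieties of low
dimension*, Math. Ann. 315 (1999), §2, `g = 1`, Type I(1); the CM case gives the torus `U_F`).
Stripped of the language of algebraic groups, the mechanism is a statement about Lie subalgebras
of `𝔰𝔩₂` over a field extension `F → K` (`ℚ → ℝ` or `ℚ → ℂ` in the application), which is what
this file proves, in two forms.

* `mem_span_rational_sl2_of_noRationalEigenline`: let `T ⊆ 𝔰𝔩₂(F)` be closed under the
  commutator and `S = K·T` the `K`-span of its image (a Lie subalgebra of `𝔰𝔩₂(K)` defined over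
  `F`). If `S` contains a matrix `J` which (i) has no eigenvector on an `F`-rational line and
  (ii) is not a `K`-multiple of an `F`-rational matrix, then `S = 𝔰𝔩₂(K)`.
  Trichotomy on `dim_K S ∈ {1, 2, 3}`: `dim 1` means `S = K·A` with `A` rational, excluded by
  (ii); `dim 2` means `S = ⟨g₁, g₂⟩` with `y = [g₁, g₂] ≠ 0` (the centraliser of a nonzero
  element of `𝔰𝔩₂` is a line), `[S, S] = K·y`, `[g, y] = λy` for some `g ∈ S`, `λ ≠ 0`
  (Humphreys §1.4: the non-abelian two-dimensional Lie algebra), hence `tr(y²) = 0`, `y² = 0`,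
  and every element of `S` preserves the line `ker y`, which is `F`-rational because `y` is the
  image of the rational commutator `[A₁, A₂]` — excluded by (i).
* `sl2_annihilator_of_noRationalEigenline`: the annihilator form used on tensors. For an
  `F`-linear `Φ₀ : 𝔤𝔩₂(F) → (X → F)` with base change `Φ`, whose trace-zero kernel is closed
  under commutators (e.g. `Φ₀(A) = A·c`, the action on a rational tensor `c`), `Φ(J) = 0` for a
  trace-zero `J` as above forces `Φ = 0` on `𝔰𝔩₂(K)`. The rationality input — `K`-linear
  relations among rational vectors are spanned by rational relations — is proved in coordinates
  from an `F`-basis of `K` (`mem_span_of_sum_mul_algebraMap_eq_zero`).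

* `sl2_annihilator_of_complexStructure_of_noCM`: the same with (i), (ii) and `tr J = 0` DERIVED
  from `J² = −1` (over a field in which `−1` is not a square, e.g. `ℝ`) and "the only rational
  matrices commuting with `J` are scalars" — the Hodge-theoretic form of "no complex
  multiplication" for the weight-one Hodge structure with complex structure `J`.

In the application (`F = ℚ`, `K = ℝ`), `J = J_τ` is the complex structure of `H¹(E_τ, ℝ)`:
(i) holds always (the eigenlines `H^{1,0}`, `H^{0,1}` are not real), (ii) says exactly that `E_τ`
has no complex multiplication (a rational matrix proportional to `J_τ` is a Hodge endomorphism),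
and `Φ(J) c = 0` says that the rational tensor `c` has pure Hodge type `(p, p)`; the conclusion
`𝔰𝔩₂ · c = 0` feeds `WordRaisingOperator.mem_span_polytabloid_rect_of_wordRaise_eq_zero`
(the first fundamental theorem for `SL₂`). No Hodge theory is imported here.

Rev. 2 (brick R1b of the Literature lane's real-multiplication programme) adds
`mem_span_rational_sl2_of_noRationalEigenline_of_nonabelian`: the same trichotomy with (ii) replaced
by "`T` is not commutative" — for real multiplication by a totally real field `E` of degree `dim X`
the slots are the real places `σ` of `E`, `F` is the Galois closure of `E` in `ℝ`, `J_σ` is a REAL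
matrix with eigenvalues `±i` (so (i) holds) but may well be proportional to an `F`-rational matrix
(so (ii) may fail), while non-commutativity of the `ℚ`-Lie hull is what `End⁰(X) = E` supplies
(Hazama 1983 §3: `p_i(𝔥) = 𝔰𝔩₂`).

## References

* B. J. J. Moonen, Yu. G. Zarhin, *Hodge classes on abelian varieties of low dimension*,
  Math. Ann. 315 (1999) 711–733, §2 (`g = 1`: Type I(1), `Hg(X) = Sp(V, φ) ≅ SL_{2,ℚ}`;
  Type IV(1,1), `Hg(X) = U_F`). [cite: MoonenZarhin1999LowDim, §2 (g = 1)]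
* J. E. Humphreys, *Introduction to Lie Algebras and Representation Theory*, GTM 9 (1972),
  §1.4 (Lie algebras of dimension ≤ 2), §4.1 (Lie's theorem: a common eigenvector).
  [cite: Humphreys1972, §1.4]
* F. Hazama, *Algebraic cycles on abelian varieties with many real endomorphisms*, Tôhoku Math. J.
  35 (1983) 303–308 (held: `paper:doi-10-2748-tmj-1178229056`), §3 pp. 305–306 (for `A` simple of
  type I with `End⁰ A` a totally real field of degree `dim A`: the Lie algebra `𝔥` of `Hg(A)_ℂ` has
  `p_i(𝔥) = 𝔰𝔩₂` on every two-dimensional summand `V_i` of `H¹(A, ℂ)`, then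
  `𝔥 = 𝔰𝔩₂ × ⋯ × 𝔰𝔩₂` by Ribet's lemma Prop. (2.6) and Lemma (3.1)). [cite: Hazama1983, §3 and Thm. (1.1)]

## Design

Plain `2 × 2` matrices and commutators `A * B - B * A` (no `LieSubalgebra` API): the consumer
works with explicit operators. `F → K` is any `[Algebra F K]` of fields with `char K = 0`
(`char ≠ 2` is what the proofs use). Private lemmas: the centraliser of `X ≠ 0` in `𝔰𝔩₂` is
`K·X`; the kernel of a nonzero `2 × 2` matrix is at most a line; `tr y = tr y² = 0 ⟹ y² = 0`;
a nonzero square-zero matrix has a nonzero rational kernel vector (a column); descent of linear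
relations; `[a g₁ + b g₂, α g₁ + β g₂] = (aβ − bα)[g₁, g₂]`.
-/

namespace Literature.RepresentationTheory.GeneralLinear

open Matrix

section Elementary

variable {K : Type*} [Field K]

/-- In `𝔰𝔩₂(K)` (`char K ≠ 2`) the centraliser of a nonzero element `X` is the line `K·X`:
trace-zero `2 × 2` matrices `X ≠ 0`, `Y` with `XY = YX` satisfy `Y = μX`. [folklore] -/
private theorem exists_eq_smul_of_commute [CharZero K] {X Y : Matrix (Fin 2) (Fin 2) K}
    (hX : X.trace = 0) (hY : Y.trace = 0) (hX0 : X ≠ 0) (h : X * Y = Y * X) :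
    ∃ μ : K, Y = μ • X := by
  have hX11 : X 1 1 = -X 0 0 := by
    rw [Matrix.trace_fin_two] at hX; linear_combination hX
  have hY11 : Y 1 1 = -Y 0 0 := by
    rw [Matrix.trace_fin_two] at hY; linear_combination hY
  have e00 := congrFun (congrFun h 0) 0
  have e01 := congrFun (congrFun h 0) 1
  have e10 := congrFun (congrFun h 1) 0
  simp only [Matrix.mul_apply, Fin.sum_univ_two] at e00 e01 e10
  rw [hX11, hY11] at e01 e10
  have two : (2 : K) ≠ 0 := two_ne_zero
  -- r1 : b f = e c ;  r2 : a e = b d ;  r3 : c d = a f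
  have r1 : X 0 1 * Y 1 0 = Y 0 1 * X 1 0 := by linear_combination e00
  have r2 : X 0 0 * Y 0 1 = X 0 1 * Y 0 0 := by
    have : (2 : K) * (X 0 0 * Y 0 1 - X 0 1 * Y 0 0) = 0 := by linear_combination e01
    have := (mul_eq_zero.1 this).resolve_left two
    linear_combination this
  have r3 : X 1 0 * Y 0 0 = X 0 0 * Y 1 0 := by
    have : (2 : K) * (X 1 0 * Y 0 0 - X 0 0 * Y 1 0) = 0 := by linear_combination e10
    have := (mul_eq_zero.1 this).resolve_left two
    linear_combination this
  -- a witness `μ` with the four entry identities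
  suffices hμ : ∃ μ : K, Y 0 0 = μ * X 0 0 ∧ Y 0 1 = μ * X 0 1 ∧ Y 1 0 = μ * X 1 0 by
    obtain ⟨μ, h00, h01, h10⟩ := hμ
    refine ⟨μ, ?_⟩
    ext i j
    fin_cases i <;> fin_cases j
    · simpa using h00
    · simpa using h01
    · simpa using h10
    · simp only [Fin.mk_one, Fin.isValue, smul_apply, smul_eq_mul]
      rw [hY11, hX11, h00]; ring
  by_cases ha : X 0 0 ≠ 0
  · refine ⟨Y 0 0 / X 0 0, ?_, ?_, ?_⟩
    · field_simp
    · field_simp; linear_combination r2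
    · field_simp; linear_combination -r3
  rw [not_not] at ha
  by_cases hb : X 0 1 ≠ 0
  · have hd : Y 0 0 = 0 := by
      have : X 0 1 * Y 0 0 = 0 := by rw [← r2, ha, zero_mul]
      exact (mul_eq_zero.1 this).resolve_left hb
    refine ⟨Y 0 1 / X 0 1, ?_, ?_, ?_⟩
    · rw [hd, ha, mul_zero]
    · field_simp
    · field_simp; linear_combination r1
  rw [not_not] at hb
  have hc : X 1 0 ≠ 0 := by
    intro hc
    apply hX0
    ext i j
    fin_cases i <;> fin_cases j
    · simpa using ha
    · simpa using hb
    · simpa using hc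
    · simp only [Fin.mk_one, Fin.isValue, zero_apply]; rw [hX11, ha, neg_zero]
  have hd : Y 0 0 = 0 := by
    have : X 1 0 * Y 0 0 = 0 := by rw [r3, ha, zero_mul]
    exact (mul_eq_zero.1 this).resolve_left hc
  have he : Y 0 1 = 0 := by
    have : Y 0 1 * X 1 0 = 0 := by rw [← r1, hb, zero_mul]
    exact (mul_eq_zero.1 this).resolve_right hc
  refine ⟨Y 1 0 / X 1 0, ?_, ?_, ?_⟩
  · rw [hd, ha, mul_zero]
  · rw [he, hb, mul_zero]
  · field_simp

/-- The kernel of a nonzero `2 × 2` matrix is at most a line: if `y ≠ 0` kills `v ≠ 0` and `w`,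
then `w ∈ K·v`. [folklore] -/
private theorem exists_eq_smul_of_mulVec_eq_zero {y : Matrix (Fin 2) (Fin 2) K} (hy : y ≠ 0)
    {v w : Fin 2 → K} (hv0 : v ≠ 0) (hv : y.mulVec v = 0) (hw : y.mulVec w = 0) :
    ∃ μ : K, w = μ • v := by
  have hv' : ∀ i, y i 0 * v 0 + y i 1 * v 1 = 0 := fun i => by
    have := congrFun hv i
    simpa [Matrix.mulVec, dotProduct, Fin.sum_univ_two] using this
  have hw' : ∀ i, y i 0 * w 0 + y i 1 * w 1 = 0 := fun i => by
    have := congrFun hw i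
    simpa [Matrix.mulVec, dotProduct, Fin.sum_univ_two] using this
  by_cases hD : v 0 * w 1 - v 1 * w 0 = 0
  · by_cases h0 : v 0 ≠ 0
    · refine ⟨w 0 / v 0, ?_⟩
      funext i
      fin_cases i
      · simp only [Fin.zero_eta, Fin.isValue, Pi.smul_apply, smul_eq_mul]; field_simp
      · simp only [Fin.mk_one, Fin.isValue, Pi.smul_apply, smul_eq_mul]
        field_simp; linear_combination hD
    · rw [not_not] at h0
      have h1 : v 1 ≠ 0 := by
        intro h1; apply hv0; funext i; fin_cases i
        · simpa using h0
        · simpa using h1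
      have hw0 : w 0 = 0 := by
        rw [h0, zero_mul, zero_sub, neg_eq_zero] at hD
        exact (mul_eq_zero.1 hD).resolve_left h1
      refine ⟨w 1 / v 1, ?_⟩
      funext i
      fin_cases i
      · simp only [Fin.zero_eta, Fin.isValue, Pi.smul_apply, smul_eq_mul]
        rw [hw0, h0, mul_zero]
      · simp only [Fin.mk_one, Fin.isValue, Pi.smul_apply, smul_eq_mul]; field_simp
  · exfalso
    apply hy
    ext i j
    have h₀ : y i 0 * (v 0 * w 1 - v 1 * w 0) = 0 := by
      linear_combination (w 1) * hv' i - (v 1) * hw' i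
    have h₁ : y i 1 * (v 0 * w 1 - v 1 * w 0) = 0 := by
      linear_combination (-(w 0)) * hv' i + (v 0) * hw' i
    have h₀ := (mul_eq_zero.1 h₀).resolve_right hD
    have h₁ := (mul_eq_zero.1 h₁).resolve_right hD
    fin_cases j
    · simpa using h₀
    · simpa using h₁

/-- A trace-zero `2 × 2` matrix with `tr(y²) = 0` squares to zero (`char K ≠ 2`; Cayley–Hamilton:
`y² = −det(y)·1`, `tr(y²) = −2 det y`). [folklore] -/
private theorem mul_self_eq_zero_of_trace [CharZero K] {y : Matrix (Fin 2) (Fin 2) K}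
    (h1 : y.trace = 0) (h2 : (y * y).trace = 0) : y * y = 0 := by
  have hy11 : y 1 1 = -y 0 0 := by
    rw [Matrix.trace_fin_two] at h1; linear_combination h1
  rw [Matrix.trace_fin_two] at h2
  simp only [Matrix.mul_apply, Fin.sum_univ_two] at h2
  rw [hy11] at h2
  have hs : y 0 0 * y 0 0 + y 0 1 * y 1 0 = 0 := by
    have : (2 : K) * (y 0 0 * y 0 0 + y 0 1 * y 1 0) = 0 := by linear_combination h2
    exact (mul_eq_zero.1 this).resolve_left two_ne_zero
  ext i j
  fin_cases i <;> fin_cases j <;>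
    simp only [Fin.zero_eta, Fin.mk_one, Fin.isValue, Matrix.mul_apply, Fin.sum_univ_two,
      Matrix.zero_apply, hy11]
  · linear_combination hs
  · ring
  · ring
  · linear_combination hs

/-- A nonzero square-zero matrix over a field has a nonzero kernel vector with entries in that
field: a nonzero column. [folklore] -/
private theorem exists_mulVec_eq_zero_of_mul_self_eq_zero {F : Type*} [Field F] {n : ℕ}
    {A : Matrix (Fin n) (Fin n) F} (hA : A ≠ 0) (hAA : A * A = 0) :
    ∃ v : Fin n → F, v ≠ 0 ∧ A.mulVec v = 0 := by
  obtain ⟨i, j, hij⟩ : ∃ i j, A i j ≠ 0 := by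
    by_contra h
    simp only [not_exists, not_not] at h
    exact hA (Matrix.ext fun i j => by rw [Matrix.zero_apply]; exact h i j)
  refine ⟨fun i' => A i' j, fun h => hij (by simpa using congrFun h i), ?_⟩
  funext i'
  have := congrFun (congrFun hAA i') j
  simpa [Matrix.mul_apply, Matrix.mulVec, dotProduct] using this

end Elementary

section Descent

variable {F K : Type*} [Field F] [Field K] [Algebra F K]

/-- **`K`-linear relations among `F`-rational vectors are spanned by `F`-rational relations**
(kernels commute with extension of scalars, in coordinates): if `∑ᵢ uᵢ aᵢ = 0` with `uᵢ ∈ K` and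
`aᵢ : X → F`, then `u` is a `K`-linear combination of (images of) `F`-rational relation vectors
`r`, `∑ᵢ rᵢ aᵢ = 0`. Proof: expand the `uᵢ` in an `F`-basis of `K`. [folklore] -/
private theorem mem_span_of_sum_mul_algebraMap_eq_zero {X : Type*} {n : ℕ} (a : Fin n → X → F)
    (u : Fin n → K) (h : ∀ x, ∑ i, u i * algebraMap F K (a i x) = 0) :
    u ∈ Submodule.span K
      ((fun r : Fin n → F => fun i => algebraMap F K (r i)) '' {r | ∀ x, ∑ i, r i * a i x = 0}) := by
  classical
  set B := Module.Basis.ofVectorSpace F K with hB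
  -- the rational relation vectors `r_k`, one for each basis vector `B k`
  set r : Module.Basis.ofVectorSpaceIndex F K → Fin n → F := fun k i => B.repr (u i) k with hr
  have hrR : ∀ k, r k ∈ {r : Fin n → F | ∀ x, ∑ i, r i * a i x = 0} := by
    intro k x
    have hx : ∑ i, a i x • u i = 0 := by
      rw [← h x]
      exact Finset.sum_congr rfl fun i _ => by rw [Algebra.smul_def, mul_comm]
    have := congrArg (fun z => B.repr z k) hx
    simp only [map_sum, map_smul, map_zero, Finsupp.coe_finsetSum, Finsupp.coe_smul,
      Finset.sum_apply, Pi.smul_apply, smul_eq_mul, Finsupp.coe_zero, Pi.zero_apply] at this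
    rw [← this]
    exact Finset.sum_congr rfl fun i _ => by rw [hr, mul_comm]
  -- a finite set of basis indices carrying all coordinates of the `u i`
  set S₀ : Finset (Module.Basis.ofVectorSpaceIndex F K) :=
    Finset.univ.biUnion fun i => (B.repr (u i)).support with hS₀
  have hu : u = ∑ k ∈ S₀, B k • fun i => algebraMap F K (r k i) := by
    funext i
    rw [Finset.sum_apply]
    simp only [Pi.smul_apply, smul_eq_mul, hr]
    have hsub : (B.repr (u i)).support ⊆ S₀ :=
      Finset.subset_biUnion_of_mem (fun i => (B.repr (u i)).support) (Finset.mem_univ i)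
    have := B.linearCombination_repr (u i)
    rw [Finsupp.linearCombination_apply, Finsupp.sum_of_support_subset _ hsub _
      (fun k _ => zero_smul F (B k))] at this
    rw [← this]
    refine Finset.sum_congr rfl fun k _ => ?_
    · rw [Algebra.smul_def, mul_comm, this]
  rw [hu]
  exact Submodule.sum_mem _ fun k _ =>
    Submodule.smul_mem _ _ (Submodule.subset_span ⟨r k, hrR k, rfl⟩)

end Descent

section Bracket

variable {K : Type*} [Field K] {R : Type*} [Ring R] [Algebra K R]

/-- In a two-generator span every bracket is a multiple of `[g₁, g₂]`:
`[a g₁ + b g₂, α g₁ + β g₂] = (aβ − bα)[g₁, g₂]`. [folklore] -/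
private theorem bracket_pair (g₁ g₂ : R) (a b α β : K) :
    (a • g₁ + b • g₂) * (α • g₁ + β • g₂) - (α • g₁ + β • g₂) * (a • g₁ + b • g₂) =
      (a * β - b * α) • (g₁ * g₂ - g₂ * g₁) := by
  simp only [add_mul, mul_add, smul_mul_assoc, mul_smul_comm]
  module

end Bracket

section Main

variable {F K : Type*} [Field F] [Field K] [CharZero K] [Algebra F K]

/-- The standard basis `e, h, f` of `𝔰𝔩₂`. [folklore] -/
private def slE (R : Type*) [Ring R] : Matrix (Fin 2) (Fin 2) R := !![0, 1; 0, 0]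
/-- The standard basis `e, h, f` of `𝔰𝔩₂`. [folklore] -/
private def slH (R : Type*) [Ring R] : Matrix (Fin 2) (Fin 2) R := !![1, 0; 0, -1]
/-- The standard basis `e, h, f` of `𝔰𝔩₂`. [folklore] -/
private def slF (R : Type*) [Ring R] : Matrix (Fin 2) (Fin 2) R := !![0, 0; 1, 0]

/-- A trace-zero `2 × 2` matrix in the basis `e, h, f`. [folklore] -/
private theorem eq_smul_slEHF {R : Type*} [CommRing R] (X : Matrix (Fin 2) (Fin 2) R)
    (hX : X.trace = 0) : X = X 0 1 • slE R + X 0 0 • slH R + X 1 0 • slF R := by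
  have h11 : X 1 1 = -X 0 0 := by
    rw [Matrix.trace_fin_two] at hX; linear_combination hX
  ext i j
  fin_cases i <;> fin_cases j <;> simp [slE, slH, slF, h11]

/-- **Trichotomy for Lie subalgebras of `𝔰𝔩₂` defined over a subfield.** Let `F → K` be fields of
characteristic zero, `T` a set of trace-zero `2 × 2` matrices over `F` closed under the commutator,
and `S = K·T ⊆ 𝔰𝔩₂(K)` the `K`-span of their images (a Lie subalgebra defined over `F`). If `S`
contains a matrix `J` which (i) has no eigenvector on an `F`-rational line and (ii) is not a
`K`-multiple of an `F`-rational matrix, then `S = 𝔰𝔩₂(K)`. Indeed `dim S = 1` forces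
`S = K·A`, `A` rational, contradicting (ii); `dim S = 2` forces `S = ⟨g₁, g₂⟩` with
`y = [g₁, g₂] ≠ 0` (the centraliser of `g₁ ≠ 0` in `𝔰𝔩₂` is a line), `[S, S] = K·y`, some
`[g, y] = λy` with `λ ≠ 0`, hence `tr y² = 0`, `y² = 0`, and `S` stabilises the `F`-rational line
`ker y`, contradicting (i) (Humphreys §1.4: the two-dimensional Lie algebras; §4.1/§4.3: a common
eigenvector for a solvable linear Lie algebra). This is the Lie-algebra mechanism behind
"`Hg(X) = SL₂` for an elliptic curve `X` with `End⁰(X) = ℚ`" (Moonen–Zarhin: the Hodge group is the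
smallest `ℚ`-group whose real Lie algebra contains the complex structure `J = h(i)`; for `g = 1`,
Type I(1), it is all of `Sp(V, φ) = SL₂`), in the elementary form used on tensors: see
`sl2_annihilator_eq_of_noRationalEigenline`. [cite: MoonenZarhin1999LowDim, §2 (g = 1), Type I(1)]
[cite: Humphreys1972, §1.4] -/
theorem mem_span_rational_sl2_of_noRationalEigenline (T : Set (Matrix (Fin 2) (Fin 2) F))
    (hT : ∀ A ∈ T, A.trace = 0) (hlie : ∀ A ∈ T, ∀ B ∈ T, A * B - B * A ∈ T)
    {J : Matrix (Fin 2) (Fin 2) K}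
    (hJ : J ∈ Submodule.span K ((fun A : Matrix (Fin 2) (Fin 2) F => A.map (algebraMap F K)) '' T))
    (hi : ∀ v : Fin 2 → F, v ≠ 0 → ∀ μ : K,
      J.mulVec (fun i => algebraMap F K (v i)) ≠ μ • fun i => algebraMap F K (v i))
    (hii : ∀ (A : Matrix (Fin 2) (Fin 2) F) (μ : K), J ≠ μ • A.map (algebraMap F K))
    (X : Matrix (Fin 2) (Fin 2) K) (hX : X.trace = 0) :
    X ∈ Submodule.span K ((fun A : Matrix (Fin 2) (Fin 2) F => A.map (algebraMap F K)) '' T) := by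
  classical
  set mp : Matrix (Fin 2) (Fin 2) F → Matrix (Fin 2) (Fin 2) K :=
    fun A => A.map (algebraMap F K) with hmp
  set S := Submodule.span K (mp '' T) with hS_def
  have hinj : Function.Injective mp := Matrix.map_injective (algebraMap F K).injective
  have mp_mul : ∀ A B, mp (A * B) = mp A * mp B := fun A B => Matrix.map_mul
  have mp_sub : ∀ A B, mp (A - B) = mp A - mp B := fun A B =>
    Matrix.map_sub (algebraMap F K) (map_sub (algebraMap F K)) A B
  have mp_zero : mp 0 = 0 := Matrix.map_zero (algebraMap F K) (map_zero _)
  -- `𝔰𝔩₂(K)` as the span `L` of `e, h, f`; `S ≤ L`; `dim L ≤ 3`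
  set Lfin : Finset (Matrix (Fin 2) (Fin 2) K) := {slE K, slH K, slF K} with hLfin
  set L := Submodule.span K (Lfin : Set (Matrix (Fin 2) (Fin 2) K)) with hL
  have mem_L : ∀ Y : Matrix (Fin 2) (Fin 2) K, Y.trace = 0 → Y ∈ L := by
    intro Y hY
    rw [eq_smul_slEHF Y hY]
    refine Submodule.add_mem _ (Submodule.add_mem _ ?_ ?_) ?_ <;>
      refine Submodule.smul_mem _ _ (Submodule.subset_span (Finset.mem_coe.2 ?_)) <;>
      simp [hLfin]
  have trace_mp : ∀ A ∈ T, (mp A).trace = 0 := by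
    intro A hA
    have := hT A hA
    rw [Matrix.trace_fin_two] at this ⊢
    simp only [hmp, Matrix.map_apply]
    rw [← map_add, this, map_zero]
  have trace_S : ∀ Y ∈ S, Y.trace = 0 := by
    intro Y hY
    refine Submodule.span_induction (p := fun Y _ => Y.trace = 0) ?_ ?_ ?_ ?_ hY
    · rintro _ ⟨A, hA, rfl⟩
      exact trace_mp A hA
    · exact Matrix.trace_zero _ _
    · intro x y _ _ hx hy
      rw [Matrix.trace_add, hx, hy, add_zero]
    · intro c x _ hx
      rw [Matrix.trace_smul, hx, smul_zero]
  have hSL : S ≤ L := fun Y hY => mem_L Y (trace_S Y hY)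
  have hL3 : Module.finrank K L ≤ 3 :=
    (finrank_span_finset_le_card Lfin).trans Finset.card_le_three
  have hS3 : Module.finrank K S ≤ 3 := (Submodule.finrank_mono hSL).trans hL3
  -- `J ≠ 0`, so some generator is nonzero
  have hJ0 : J ≠ 0 := by
    intro hJ0
    refine hi (Pi.single (0 : Fin 2) (1 : F))
      (fun h => (one_ne_zero : (1 : F) ≠ 0) (by simpa using congrFun h 0)) 0 ?_
    rw [hJ0, Matrix.zero_mulVec, zero_smul]
  obtain ⟨A₁, hA₁T, hA₁⟩ : ∃ A₁ ∈ T, mp A₁ ≠ 0 := by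
    by_contra hc
    simp only [not_exists, not_and, not_not] at hc
    apply hJ0
    have : S ≤ ⊥ := Submodule.span_le.2 (by
      rintro _ ⟨A, hA, rfl⟩
      rw [hc A hA]
      exact (Submodule.mem_bot K).2 rfl)
    exact (Submodule.mem_bot K).1 (this hJ)
  set g₁ := mp A₁ with hg₁
  have hg₁S : g₁ ∈ S := Submodule.subset_span ⟨A₁, hA₁T, rfl⟩
  set S₁ := Submodule.span K ({g₁} : Set (Matrix (Fin 2) (Fin 2) K)) with hS₁
  have hS₁S : S₁ ≤ S := Submodule.span_le.2 (by simpa using hg₁S)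
  have hS₁1 : Module.finrank K S₁ = 1 := finrank_span_singleton hA₁
  have hd : Module.finrank K S = 1 ∨ Module.finrank K S = 2 ∨ Module.finrank K S = 3 := by
    have h1 : 1 ≤ Module.finrank K S := hS₁1 ▸ Submodule.finrank_mono hS₁S
    omega
  rcases hd with hd | hd | hd
  · -- `dim S = 1`: `S = K·g₁`, so `J = μ g₁` — contradicts (ii)
    exfalso
    have hSS₁ : S₁ = S := Submodule.eq_of_le_of_finrank_eq hS₁S (by rw [hS₁1, hd])
    obtain ⟨μ, hμ⟩ := Submodule.mem_span_singleton.1 (hSS₁ ▸ hJ : J ∈ S₁)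
    exact hii A₁ μ hμ.symm
  · -- `dim S = 2`
    exfalso
    obtain ⟨A₂, hA₂T, hA₂⟩ : ∃ A₂ ∈ T, mp A₂ ∉ S₁ := by
      by_contra hc
      simp only [not_exists, not_and, not_not] at hc
      have hle : S ≤ S₁ := Submodule.span_le.2 (by
        rintro _ ⟨A, hA, rfl⟩
        exact hc A hA)
      have := Submodule.finrank_mono hle
      rw [hd, hS₁1] at this
      omega
    set g₂ := mp A₂ with hg₂
    have hg₂S : g₂ ∈ S := Submodule.subset_span ⟨A₂, hA₂T, rfl⟩
    set S₂ := Submodule.span K ({g₁, g₂} : Set (Matrix (Fin 2) (Fin 2) K)) with hS₂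
    have hS₂S : S₂ ≤ S := Submodule.span_le.2 (by
      intro x hx
      rcases hx with rfl | hx
      · exact hg₁S
      · rw [Set.mem_singleton_iff.1 hx]; exact hg₂S)
    have hS₁S₂ : S₁ < S₂ := by
      refine lt_of_le_of_ne (Submodule.span_mono (by simp)) fun h => hA₂ ?_
      rw [h]
      exact Submodule.subset_span (by simp)
    have hS₂2 : Module.finrank K S₂ = 2 := by
      have h1 := Submodule.finrank_lt_finrank_of_lt hS₁S₂
      have h2 := Submodule.finrank_mono hS₂S
      rw [hS₁1] at h1
      rw [hd] at h2
      omega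
    have hSS₂ : S₂ = S := Submodule.eq_of_le_of_finrank_eq hS₂S (by rw [hS₂2, hd])
    have mem_S : ∀ Y ∈ S, ∃ a b : K, a • g₁ + b • g₂ = Y := fun Y hY =>
      Submodule.mem_span_pair.1 (hSS₂ ▸ hY : Y ∈ S₂)
    -- `y = [g₁, g₂]`, the image of the rational commutator `B₀`
    set B₀ := A₁ * A₂ - A₂ * A₁ with hB₀
    have hB₀T : B₀ ∈ T := hlie A₁ hA₁T A₂ hA₂T
    set y := g₁ * g₂ - g₂ * g₁ with hy
    have hmpB₀ : mp B₀ = y := by rw [hB₀, mp_sub, mp_mul, mp_mul]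
    have hyS : y ∈ S := hmpB₀ ▸ Submodule.subset_span ⟨B₀, hB₀T, rfl⟩
    have htrg₁ : g₁.trace = 0 := trace_mp A₁ hA₁T
    have htrg₂ : g₂.trace = 0 := trace_mp A₂ hA₂T
    have htry : y.trace = 0 := trace_S y hyS
    have hy0 : y ≠ 0 := by
      intro hy0
      have hcomm : g₁ * g₂ = g₂ * g₁ := sub_eq_zero.1 hy0
      obtain ⟨μ, hμ⟩ := exists_eq_smul_of_commute htrg₁ htrg₂ hA₁ hcomm
      exact hA₂ (Submodule.mem_span_singleton.2 ⟨μ, hμ.symm⟩)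
    obtain ⟨α, β, hαβ⟩ := mem_S y hyS
    -- an `ad`-eigenvalue `λ ≠ 0` on `y`
    obtain ⟨g, l, hl0, hgy⟩ :
        ∃ g : Matrix (Fin 2) (Fin 2) K, ∃ l : K, l ≠ 0 ∧ g * y - y * g = l • y := by
      by_cases hβ : β ≠ 0
      · refine ⟨g₁, β, hβ, ?_⟩
        have := bracket_pair g₁ g₂ 1 0 α β
        rw [one_smul, zero_smul, add_zero, hαβ] at this
        rw [this]
        congr 1
        ring
      · rw [not_not] at hβ
        have hα : α ≠ 0 := by
          rintro rfl
          apply hy0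
          rw [← hαβ, hβ, zero_smul, zero_smul, add_zero]
        refine ⟨g₂, -α, neg_ne_zero.2 hα, ?_⟩
        have := bracket_pair g₁ g₂ 0 1 α β
        rw [one_smul, zero_smul, zero_add, hαβ] at this
        rw [this]
        congr 1
        ring
    -- hence `tr(y²) = 0` and `y² = 0`
    have htryy : (y * y).trace = 0 := by
      have h1 : (g * y - y * g) * y = l • (y * y) := by rw [hgy, smul_mul_assoc]
      have h2 := congrArg Matrix.trace h1
      rw [sub_mul, Matrix.trace_sub, Matrix.trace_mul_comm (g * y) y, ← Matrix.mul_assoc,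
        sub_self, Matrix.trace_smul] at h2
      exact (smul_eq_zero.1 h2.symm).resolve_left hl0
    have hyy : y * y = 0 := mul_self_eq_zero_of_trace htry htryy
    -- the rational line `ker y = K · v`, `v = ι ∘ v₀`
    have hB₀0 : B₀ ≠ 0 := by
      intro h
      apply hy0
      rw [← hmpB₀, h, mp_zero]
    have hB₀sq : B₀ * B₀ = 0 := by
      apply hinj
      rw [mp_mul, hmpB₀, hyy, mp_zero]
    obtain ⟨v₀, hv₀0, hv₀⟩ := exists_mulVec_eq_zero_of_mul_self_eq_zero hB₀0 hB₀sq
    set v : Fin 2 → K := fun i => algebraMap F K (v₀ i) with hv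
    have hv0 : v ≠ 0 := by
      intro h
      apply hv₀0
      funext i
      have hi' : algebraMap F K (v₀ i) = 0 := by simpa [hv] using congrFun h i
      exact (algebraMap F K).injective (by rw [hi', Pi.zero_apply, map_zero])
    have hyv : y.mulVec v = 0 := by
      rw [← hmpB₀]
      funext i
      have := RingHom.map_mulVec (algebraMap F K) B₀ v₀ i
      rw [hv₀, Pi.zero_apply, map_zero] at this
      rw [Pi.zero_apply, this]
      rfl
    -- `J ∈ S` stabilises the line, so `v` is an eigenvector of `J` — contradicts (i)
    obtain ⟨a, b, hab⟩ := mem_S J hJ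
    have hJy : J * y - y * J = (a * β - b * α) • y := by
      have := bracket_pair g₁ g₂ a b α β
      rwa [hab, hαβ] at this
    have hyJv : y.mulVec (J.mulVec v) = 0 := by
      have : y * J = J * y - (a * β - b * α) • y := by rw [← hJy]; abel
      rw [Matrix.mulVec_mulVec, this, Matrix.sub_mulVec, Matrix.smul_mulVec,
        ← Matrix.mulVec_mulVec, hyv, Matrix.mulVec_zero, smul_zero, sub_zero]
    obtain ⟨μ, hμ⟩ := exists_eq_smul_of_mulVec_eq_zero hy0 hv0 hyv hyJv
    exact hi v₀ hv₀0 μ hμ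
  · -- `dim S = 3`: `S = 𝔰𝔩₂(K)`
    have hSL' : S = L := Submodule.eq_of_le_of_finrank_le hSL (by rw [hd]; exact hL3)
    rw [hSL']
    exact mem_L X hX

/-- **Annihilator form (the version used on tensors).** Let `Φ₀ : 𝔤𝔩₂(F) → (X → F)` be `F`-linear
with base change `Φ : 𝔤𝔩₂(K) → (X → K)` (`Φ(A) = Φ₀(A)` on `F`-rational `A`), and suppose the
trace-zero part of `ker Φ₀` is closed under commutators (e.g. `Φ₀(A) = ρ(A)c` for a representation
`ρ` of `𝔤𝔩₂(F)` and a rational vector `c`). If `Φ(J) = 0` for a trace-zero `J ∈ 𝔤𝔩₂(K)` which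
(i) has no eigenvector on an `F`-rational line and (ii) is not a `K`-multiple of an `F`-rational
matrix, then `Φ` kills all of `𝔰𝔩₂(K)`. (Rationality input: `K`-linear relations among the
rational vectors `Φ₀(e), Φ₀(h), Φ₀(f)` are spanned by `F`-rational ones, so `J` lies in the
`K`-span of the rational annihilator, to which `mem_span_rational_sl2_of_noRationalEigenline`
applies.) For `F = ℚ ⊂ K = ℝ` (or `ℂ`), `X` = words, `Φ₀(A) = A·c` the derivation action on a
rational tensor `c ∈ (ℚ²)^{⊗n}` and `J` the complex structure of a weight-one Hodge structure on
`ℚ²` without complex multiplication, this says: a rational tensor of pure type `(p,p)` is killed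
by `𝔰𝔩₂`, i.e. is an `SL₂`-invariant — the statement "`Hg = SL₂`" of Moonen–Zarhin §2, Type I(1),
`g = 1`, in the form in which it is applied to Hodge classes on powers of the curve.
[cite: MoonenZarhin1999LowDim, §2 (g = 1), Type I(1)] -/
theorem sl2_annihilator_of_noRationalEigenline {X : Type*}
    (Φ₀ : Matrix (Fin 2) (Fin 2) F →ₗ[F] (X → F)) (Φ : Matrix (Fin 2) (Fin 2) K →ₗ[K] (X → K))
    (hΦ : ∀ (A : Matrix (Fin 2) (Fin 2) F) (x : X),
      Φ (A.map (algebraMap F K)) x = algebraMap F K (Φ₀ A x))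
    (hlie : ∀ A B : Matrix (Fin 2) (Fin 2) F, A.trace = 0 → B.trace = 0 → Φ₀ A = 0 → Φ₀ B = 0 →
      Φ₀ (A * B - B * A) = 0)
    {J : Matrix (Fin 2) (Fin 2) K} (hJtr : J.trace = 0) (hJ : Φ J = 0)
    (hi : ∀ v : Fin 2 → F, v ≠ 0 → ∀ μ : K,
      J.mulVec (fun i => algebraMap F K (v i)) ≠ μ • fun i => algebraMap F K (v i))
    (hii : ∀ (A : Matrix (Fin 2) (Fin 2) F) (μ : K), J ≠ μ • A.map (algebraMap F K))
    (Y : Matrix (Fin 2) (Fin 2) K) (hY : Y.trace = 0) : Φ Y = 0 := by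
  classical
  set T : Set (Matrix (Fin 2) (Fin 2) F) := {A | A.trace = 0 ∧ Φ₀ A = 0} with hT
  have hT0 : ∀ A ∈ T, A.trace = 0 := fun A hA => hA.1
  have hTlie : ∀ A ∈ T, ∀ B ∈ T, A * B - B * A ∈ T := fun A hA B hB =>
    ⟨by rw [Matrix.trace_sub, Matrix.trace_mul_comm, sub_self], hlie A B hA.1 hB.1 hA.2 hB.2⟩
  set S := Submodule.span K ((fun A : Matrix (Fin 2) (Fin 2) F => A.map (algebraMap F K)) '' T)
    with hS
  -- the rational basis `e, h, f` and the coordinates of `J`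
  set b : Fin 3 → Matrix (Fin 2) (Fin 2) F := ![slE F, slH F, slF F] with hb
  have hbtr : ∀ i, (b i).trace = 0 := by
    intro i
    fin_cases i <;> simp [hb, slE, slH, slF, Matrix.trace_fin_two]
  have hbmap : ∀ i, (b i).map (algebraMap F K) = (![slE K, slH K, slF K] : Fin 3 → _) i := by
    intro i
    fin_cases i <;>
      (ext i' j'; fin_cases i' <;> fin_cases j' <;> simp [hb, slE, slH, slF])
  set u : Fin 3 → K := ![J 0 1, J 0 0, J 1 0] with hu
  have hJsum : J = ∑ i, u i • (b i).map (algebraMap F K) := by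
    rw [Fin.sum_univ_three, hbmap, hbmap, hbmap]
    simp only [hu, Matrix.cons_val_zero, Matrix.cons_val_one, Matrix.cons_val_two,
      Matrix.head_cons, Matrix.tail_cons]
    exact eq_smul_slEHF J hJtr
  -- the `K`-linear relation among the rational vectors `Φ₀(b i)`
  have hrel : ∀ x, ∑ i, u i * algebraMap F K (Φ₀ (b i) x) = 0 := by
    intro x
    have h1 : Φ J x = ∑ i, u i * algebraMap F K (Φ₀ (b i) x) := by
      rw [hJsum, map_sum, Finset.sum_apply]
      refine Finset.sum_congr rfl fun i _ => ?_
      rw [map_smul, Pi.smul_apply, smul_eq_mul, hΦ]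
    rw [← h1, hJ, Pi.zero_apply]
  have hu_mem := mem_span_of_sum_mul_algebraMap_eq_zero (fun i x => Φ₀ (b i) x) u hrel
  -- push the descent through `w ↦ ∑ w i • b i`
  have map_comb : ∀ r : Fin 3 → F, (∑ i, r i • b i).map (algebraMap F K) =
      ∑ i, algebraMap F K (r i) • (b i).map (algebraMap F K) := by
    intro r
    ext i' j'
    simp only [Matrix.map_apply, Matrix.sum_apply, Matrix.smul_apply, smul_eq_mul, map_sum,
      map_mul]
  have hP : ∀ w ∈ Submodule.span K ((fun r : Fin 3 → F => fun i => algebraMap F K (r i)) ''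
      {r | ∀ x, ∑ i, r i * (fun i x => Φ₀ (b i) x) i x = 0}),
      (∑ i, w i • (b i).map (algebraMap F K)) ∈ S := by
    intro w hw
    refine Submodule.span_induction (p := fun w _ => (∑ i, w i • (b i).map (algebraMap F K)) ∈ S)
      ?_ ?_ ?_ ?_ hw
    · rintro _ ⟨r, hr, rfl⟩
      rw [← map_comb]
      refine Submodule.subset_span ⟨∑ i, r i • b i, ⟨?_, ?_⟩, rfl⟩
      · rw [Matrix.trace_sum]
        exact Finset.sum_eq_zero fun i _ => by rw [Matrix.trace_smul, hbtr, smul_zero]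
      · funext x
        rw [map_sum, Finset.sum_apply, Pi.zero_apply]
        simpa only [map_smul, Pi.smul_apply, smul_eq_mul] using hr x
    · simp
    · intro w₁ w₂ _ _ h₁ h₂
      simpa only [Pi.add_apply, add_smul, Finset.sum_add_distrib] using Submodule.add_mem _ h₁ h₂
    · intro c w _ h
      simpa only [Pi.smul_apply, smul_eq_mul, mul_smul, ← Finset.smul_sum]
        using Submodule.smul_mem _ c h
  have hJS : J ∈ S := hJsum ▸ hP u hu_mem
  -- the trichotomy, then `Φ` vanishes on `S`
  have hYS : Y ∈ S :=
    mem_span_rational_sl2_of_noRationalEigenline T hT0 hTlie hJS hi hii Y hY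
  have hSker : S ≤ LinearMap.ker Φ := by
    refine Submodule.span_le.2 ?_
    rintro _ ⟨A, hA, rfl⟩
    rw [SetLike.mem_coe, LinearMap.mem_ker]
    funext x
    rw [hΦ, hA.2, Pi.zero_apply, map_zero, Pi.zero_apply]
  exact LinearMap.mem_ker.1 (hSker hYS)


/-- **The non-abelian variant of the trichotomy** (brick R1b of the Literature lane's
real-multiplication programme): let `T ⊆ 𝔰𝔩₂(F)` be an `F`-rational set of trace-zero matrices closed
under the commutator and NOT commutative (`[A, B] ≠ 0` for some `A, B ∈ T`), and suppose the `K`-span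
`S` of `T` contains an element `J` with no eigenvector on an `F`-rational line. Then `S = 𝔰𝔩₂(K)`.
Compared with `mem_span_rational_sl2_of_noRationalEigenline`, hypothesis (ii) "`J` is no `K`-multiple
of a rational matrix" — which served only to exclude `dim S = 1` — is replaced by non-commutativity of
`T`, which excludes `dim S ≤ 1` directly (two elements of a line commute); the case `dim S = 2` is
excluded by (i) exactly as there (a two-dimensional `S ∋ J` is solvable, `[g, y] = λ y`, `y² = 0`, and
`ker y` is an `F`-rational eigenline of `J`; Humphreys §1.4, §4.1). Use: `F` = the Galois closure
`Ẽ ⊂ ℝ` of a totally real field `E`, `K = ℂ`, `T` = the `σ`-components (`σ : E → ℝ` a real place) of a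
non-commutative `ℚ`-Lie subalgebra `𝔩 ⊆ 𝔰𝔩₂(E)` whose complex span contains the Hodge operator
`J = (J_σ)_σ` of an abelian variety with real multiplication by `E` of relative dimension one: `J_σ` is a
REAL matrix with eigenvalues `±i`, so it has no `Ẽ`-rational (indeed no real) eigenline, while (ii) may
fail (e.g. `J_σ = (0 -1; 1 0)` at a special period) — whence this variant. [cite: MoonenZarhin1999LowDim, §2 (g = 1), Type I(1)]
[cite: Humphreys1972, §1.4 and §4.1] [cite: Hazama1983, §3 (p. 305–306: `p_i(𝔥) = 𝔰𝔩₂`)] -/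
theorem mem_span_rational_sl2_of_noRationalEigenline_of_nonabelian (T : Set (Matrix (Fin 2) (Fin 2) F))
    (hT : ∀ A ∈ T, A.trace = 0) (hlie : ∀ A ∈ T, ∀ B ∈ T, A * B - B * A ∈ T)
    {J : Matrix (Fin 2) (Fin 2) K}
    (hJ : J ∈ Submodule.span K ((fun A : Matrix (Fin 2) (Fin 2) F => A.map (algebraMap F K)) '' T))
    (hi : ∀ v : Fin 2 → F, v ≠ 0 → ∀ μ : K,
      J.mulVec (fun i => algebraMap F K (v i)) ≠ μ • fun i => algebraMap F K (v i))
    (hna : ∃ A ∈ T, ∃ B ∈ T, A * B - B * A ≠ 0)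
    (X : Matrix (Fin 2) (Fin 2) K) (hX : X.trace = 0) :
    X ∈ Submodule.span K ((fun A : Matrix (Fin 2) (Fin 2) F => A.map (algebraMap F K)) '' T) := by
  classical
  set mp : Matrix (Fin 2) (Fin 2) F → Matrix (Fin 2) (Fin 2) K :=
    fun A => A.map (algebraMap F K) with hmp
  set S := Submodule.span K (mp '' T) with hS_def
  have hinj : Function.Injective mp := Matrix.map_injective (algebraMap F K).injective
  have mp_mul : ∀ A B, mp (A * B) = mp A * mp B := fun A B => Matrix.map_mul
  have mp_sub : ∀ A B, mp (A - B) = mp A - mp B := fun A B =>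
    Matrix.map_sub (algebraMap F K) (map_sub (algebraMap F K)) A B
  have mp_zero : mp 0 = 0 := Matrix.map_zero (algebraMap F K) (map_zero _)
  -- `𝔰𝔩₂(K)` as the span `L` of `e, h, f`; `S ≤ L`; `dim L ≤ 3`
  set Lfin : Finset (Matrix (Fin 2) (Fin 2) K) := {slE K, slH K, slF K} with hLfin
  set L := Submodule.span K (Lfin : Set (Matrix (Fin 2) (Fin 2) K)) with hL
  have mem_L : ∀ Y : Matrix (Fin 2) (Fin 2) K, Y.trace = 0 → Y ∈ L := by
    intro Y hY
    rw [eq_smul_slEHF Y hY]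
    refine Submodule.add_mem _ (Submodule.add_mem _ ?_ ?_) ?_ <;>
      refine Submodule.smul_mem _ _ (Submodule.subset_span (Finset.mem_coe.2 ?_)) <;>
      simp [hLfin]
  have trace_mp : ∀ A ∈ T, (mp A).trace = 0 := by
    intro A hA
    have := hT A hA
    rw [Matrix.trace_fin_two] at this ⊢
    simp only [hmp, Matrix.map_apply]
    rw [← map_add, this, map_zero]
  have trace_S : ∀ Y ∈ S, Y.trace = 0 := by
    intro Y hY
    refine Submodule.span_induction (p := fun Y _ => Y.trace = 0) ?_ ?_ ?_ ?_ hY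
    · rintro _ ⟨A, hA, rfl⟩
      exact trace_mp A hA
    · exact Matrix.trace_zero _ _
    · intro x y _ _ hx hy
      rw [Matrix.trace_add, hx, hy, add_zero]
    · intro c x _ hx
      rw [Matrix.trace_smul, hx, smul_zero]
  have hSL : S ≤ L := fun Y hY => mem_L Y (trace_S Y hY)
  have hL3 : Module.finrank K L ≤ 3 :=
    (finrank_span_finset_le_card Lfin).trans Finset.card_le_three
  have hS3 : Module.finrank K S ≤ 3 := (Submodule.finrank_mono hSL).trans hL3
  -- `J ≠ 0`, so some generator is nonzero
  have hJ0 : J ≠ 0 := by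
    intro hJ0
    refine hi (Pi.single (0 : Fin 2) (1 : F))
      (fun h => (one_ne_zero : (1 : F) ≠ 0) (by simpa using congrFun h 0)) 0 ?_
    rw [hJ0, Matrix.zero_mulVec, zero_smul]
  obtain ⟨A₁, hA₁T, hA₁⟩ : ∃ A₁ ∈ T, mp A₁ ≠ 0 := by
    by_contra hc
    simp only [not_exists, not_and, not_not] at hc
    apply hJ0
    have : S ≤ ⊥ := Submodule.span_le.2 (by
      rintro _ ⟨A, hA, rfl⟩
      rw [hc A hA]
      exact (Submodule.mem_bot K).2 rfl)
    exact (Submodule.mem_bot K).1 (this hJ)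
  set g₁ := mp A₁ with hg₁
  have hg₁S : g₁ ∈ S := Submodule.subset_span ⟨A₁, hA₁T, rfl⟩
  set S₁ := Submodule.span K ({g₁} : Set (Matrix (Fin 2) (Fin 2) K)) with hS₁
  have hS₁S : S₁ ≤ S := Submodule.span_le.2 (by simpa using hg₁S)
  have hS₁1 : Module.finrank K S₁ = 1 := finrank_span_singleton hA₁
  have hd : Module.finrank K S = 1 ∨ Module.finrank K S = 2 ∨ Module.finrank K S = 3 := by
    have h1 : 1 ≤ Module.finrank K S := hS₁1 ▸ Submodule.finrank_mono hS₁S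
    omega
  rcases hd with hd | hd | hd
  · -- `dim S = 1`: `S = K·g₁`, so `T ⊆ F·A₁` up to base change is commutative — contradicts `hna`
    exfalso
    have hSS₁ : S₁ = S := Submodule.eq_of_le_of_finrank_eq hS₁S (by rw [hS₁1, hd])
    obtain ⟨A, hAT, B, hBT, hAB⟩ := hna
    obtain ⟨a, ha⟩ := Submodule.mem_span_singleton.1
      (hSS₁ ▸ (Submodule.subset_span ⟨A, hAT, rfl⟩ : mp A ∈ S) : mp A ∈ S₁)
    obtain ⟨b, hb⟩ := Submodule.mem_span_singleton.1
      (hSS₁ ▸ (Submodule.subset_span ⟨B, hBT, rfl⟩ : mp B ∈ S) : mp B ∈ S₁)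
    apply hAB
    apply hinj
    rw [mp_sub, mp_mul, mp_mul, mp_zero, ← ha, ← hb, smul_mul_smul_comm, smul_mul_smul_comm, mul_comm b a,
      sub_self]
  · -- `dim S = 2`
    exfalso
    obtain ⟨A₂, hA₂T, hA₂⟩ : ∃ A₂ ∈ T, mp A₂ ∉ S₁ := by
      by_contra hc
      simp only [not_exists, not_and, not_not] at hc
      have hle : S ≤ S₁ := Submodule.span_le.2 (by
        rintro _ ⟨A, hA, rfl⟩
        exact hc A hA)
      have := Submodule.finrank_mono hle
      rw [hd, hS₁1] at this
      omega
    set g₂ := mp A₂ with hg₂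
    have hg₂S : g₂ ∈ S := Submodule.subset_span ⟨A₂, hA₂T, rfl⟩
    set S₂ := Submodule.span K ({g₁, g₂} : Set (Matrix (Fin 2) (Fin 2) K)) with hS₂
    have hS₂S : S₂ ≤ S := Submodule.span_le.2 (by
      intro x hx
      rcases hx with rfl | hx
      · exact hg₁S
      · rw [Set.mem_singleton_iff.1 hx]; exact hg₂S)
    have hS₁S₂ : S₁ < S₂ := by
      refine lt_of_le_of_ne (Submodule.span_mono (by simp)) fun h => hA₂ ?_
      rw [h]
      exact Submodule.subset_span (by simp)
    have hS₂2 : Module.finrank K S₂ = 2 := by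
      have h1 := Submodule.finrank_lt_finrank_of_lt hS₁S₂
      have h2 := Submodule.finrank_mono hS₂S
      rw [hS₁1] at h1
      rw [hd] at h2
      omega
    have hSS₂ : S₂ = S := Submodule.eq_of_le_of_finrank_eq hS₂S (by rw [hS₂2, hd])
    have mem_S : ∀ Y ∈ S, ∃ a b : K, a • g₁ + b • g₂ = Y := fun Y hY =>
      Submodule.mem_span_pair.1 (hSS₂ ▸ hY : Y ∈ S₂)
    -- `y = [g₁, g₂]`, the image of the rational commutator `B₀`
    set B₀ := A₁ * A₂ - A₂ * A₁ with hB₀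
    have hB₀T : B₀ ∈ T := hlie A₁ hA₁T A₂ hA₂T
    set y := g₁ * g₂ - g₂ * g₁ with hy
    have hmpB₀ : mp B₀ = y := by rw [hB₀, mp_sub, mp_mul, mp_mul]
    have hyS : y ∈ S := hmpB₀ ▸ Submodule.subset_span ⟨B₀, hB₀T, rfl⟩
    have htrg₁ : g₁.trace = 0 := trace_mp A₁ hA₁T
    have htrg₂ : g₂.trace = 0 := trace_mp A₂ hA₂T
    have htry : y.trace = 0 := trace_S y hyS
    have hy0 : y ≠ 0 := by
      intro hy0
      have hcomm : g₁ * g₂ = g₂ * g₁ := sub_eq_zero.1 hy0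
      obtain ⟨μ, hμ⟩ := exists_eq_smul_of_commute htrg₁ htrg₂ hA₁ hcomm
      exact hA₂ (Submodule.mem_span_singleton.2 ⟨μ, hμ.symm⟩)
    obtain ⟨α, β, hαβ⟩ := mem_S y hyS
    -- an `ad`-eigenvalue `λ ≠ 0` on `y`
    obtain ⟨g, l, hl0, hgy⟩ :
        ∃ g : Matrix (Fin 2) (Fin 2) K, ∃ l : K, l ≠ 0 ∧ g * y - y * g = l • y := by
      by_cases hβ : β ≠ 0
      · refine ⟨g₁, β, hβ, ?_⟩
        have := bracket_pair g₁ g₂ 1 0 α β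
        rw [one_smul, zero_smul, add_zero, hαβ] at this
        rw [this]
        congr 1
        ring
      · rw [not_not] at hβ
        have hα : α ≠ 0 := by
          rintro rfl
          apply hy0
          rw [← hαβ, hβ, zero_smul, zero_smul, add_zero]
        refine ⟨g₂, -α, neg_ne_zero.2 hα, ?_⟩
        have := bracket_pair g₁ g₂ 0 1 α β
        rw [one_smul, zero_smul, zero_add, hαβ] at this
        rw [this]
        congr 1
        ring
    -- hence `tr(y²) = 0` and `y² = 0`
    have htryy : (y * y).trace = 0 := by
      have h1 : (g * y - y * g) * y = l • (y * y) := by rw [hgy, smul_mul_assoc]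
      have h2 := congrArg Matrix.trace h1
      rw [sub_mul, Matrix.trace_sub, Matrix.trace_mul_comm (g * y) y, ← Matrix.mul_assoc,
        sub_self, Matrix.trace_smul] at h2
      exact (smul_eq_zero.1 h2.symm).resolve_left hl0
    have hyy : y * y = 0 := mul_self_eq_zero_of_trace htry htryy
    -- the rational line `ker y = K · v`, `v = ι ∘ v₀`
    have hB₀0 : B₀ ≠ 0 := by
      intro h
      apply hy0
      rw [← hmpB₀, h, mp_zero]
    have hB₀sq : B₀ * B₀ = 0 := by
      apply hinj
      rw [mp_mul, hmpB₀, hyy, mp_zero]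
    obtain ⟨v₀, hv₀0, hv₀⟩ := exists_mulVec_eq_zero_of_mul_self_eq_zero hB₀0 hB₀sq
    set v : Fin 2 → K := fun i => algebraMap F K (v₀ i) with hv
    have hv0 : v ≠ 0 := by
      intro h
      apply hv₀0
      funext i
      have hi' : algebraMap F K (v₀ i) = 0 := by simpa [hv] using congrFun h i
      exact (algebraMap F K).injective (by rw [hi', Pi.zero_apply, map_zero])
    have hyv : y.mulVec v = 0 := by
      rw [← hmpB₀]
      funext i
      have := RingHom.map_mulVec (algebraMap F K) B₀ v₀ i
      rw [hv₀, Pi.zero_apply, map_zero] at this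
      rw [Pi.zero_apply, this]
      rfl
    -- `J ∈ S` stabilises the line, so `v` is an eigenvector of `J` — contradicts (i)
    obtain ⟨a, b, hab⟩ := mem_S J hJ
    have hJy : J * y - y * J = (a * β - b * α) • y := by
      have := bracket_pair g₁ g₂ a b α β
      rwa [hab, hαβ] at this
    have hyJv : y.mulVec (J.mulVec v) = 0 := by
      have : y * J = J * y - (a * β - b * α) • y := by rw [← hJy]; abel
      rw [Matrix.mulVec_mulVec, this, Matrix.sub_mulVec, Matrix.smul_mulVec,
        ← Matrix.mulVec_mulVec, hyv, Matrix.mulVec_zero, smul_zero, sub_zero]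
    obtain ⟨μ, hμ⟩ := exists_eq_smul_of_mulVec_eq_zero hy0 hv0 hyv hyJv
    exact hi v₀ hv₀0 μ hμ
  · -- `dim S = 3`: `S = 𝔰𝔩₂(K)`
    have hSL' : S = L := Submodule.eq_of_le_of_finrank_le hSL (by rw [hd]; exact hL3)
    rw [hSL']
    exact mem_L X hX

end Main

section ComplexStructure

variable {F K : Type*} [Field F] [Field K] [CharZero K] [Algebra F K]

omit [CharZero K] in
/-- A `2 × 2` matrix with `J² = −1` over a field in which `−1` is not a square has trace zero
(Cayley–Hamilton: otherwise `J` is scalar). [folklore] -/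
private theorem trace_eq_zero_of_mul_self_eq_neg_one {J : Matrix (Fin 2) (Fin 2) K}
    (hJ2 : J * J = -1) (hK : ∀ μ : K, μ * μ ≠ -1) : J.trace = 0 := by
  have e00 := congrFun (congrFun hJ2 0) 0
  have e01 := congrFun (congrFun hJ2 0) 1
  have e10 := congrFun (congrFun hJ2 1) 0
  simp only [Matrix.mul_apply, Fin.sum_univ_two, Matrix.neg_apply, Matrix.one_apply_eq,
    Matrix.one_apply_ne (show (0 : Fin 2) ≠ 1 by decide),
    Matrix.one_apply_ne (show (1 : Fin 2) ≠ 0 by decide), neg_zero] at e00 e01 e10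
  rw [Matrix.trace_fin_two]
  by_contra ht
  have hb : J 0 1 = 0 := by
    have : J 0 1 * (J 0 0 + J 1 1) = 0 := by linear_combination e01
    exact (mul_eq_zero.1 this).resolve_right ht
  have hc : J 1 0 = 0 := by
    have : J 1 0 * (J 0 0 + J 1 1) = 0 := by linear_combination e10
    exact (mul_eq_zero.1 this).resolve_right ht
  apply hK (J 0 0)
  rw [hb, zero_mul, add_zero] at e00
  exact e00

/-- **Hodge-theoretic specialisation: a complex structure without complex multiplication.** Let
`J ∈ 𝔤𝔩₂(K)` with `J² = −1`, where `−1` is not a square in `K` (e.g. `K = ℝ`; `J` = the complex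
structure `h(i)` of a weight-one Hodge structure on `F² ⊗ K`, `F = ℚ`), and suppose the only
`F`-rational matrices commuting with `J` are the scalars ("no complex multiplication":
`End_Hdg = F`). Then (i) `J` has no eigenvector at all (`μ² = −1` is insoluble), (ii) `J` is not a
`K`-multiple of a rational matrix (such a matrix would commute with `J`, hence be scalar, and `J`
would be scalar), and `tr J = 0`; so for every `F`-linear `Φ₀ : 𝔤𝔩₂(F) → (X → F)` with base change
`Φ` whose trace-zero kernel is closed under commutators, `Φ(J) = 0` forces `Φ = 0` on `𝔰𝔩₂(K)`
(`sl2_annihilator_of_noRationalEigenline`). With `Φ₀(A) = D(A)c` on a rational tensor `c`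
(`WordRaisingOperator.wordDer`), "`Φ(J) = 0`" is "`c` has pure type `(p,p)`" and the conclusion is
"`c` is an `𝔰𝔩₂`-, i.e. `SL₂`-, invariant": Moonen–Zarhin §2 (`g = 1`, Type I(1): `Hg = SL₂` when
`End⁰ = ℚ`) as it is applied to Hodge classes. [cite: MoonenZarhin1999LowDim, §2 (g = 1), Type I(1)] -/
theorem sl2_annihilator_of_complexStructure_of_noCM {X : Type*}
    (Φ₀ : Matrix (Fin 2) (Fin 2) F →ₗ[F] (X → F)) (Φ : Matrix (Fin 2) (Fin 2) K →ₗ[K] (X → K))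
    (hΦ : ∀ (A : Matrix (Fin 2) (Fin 2) F) (x : X),
      Φ (A.map (algebraMap F K)) x = algebraMap F K (Φ₀ A x))
    (hlie : ∀ A B : Matrix (Fin 2) (Fin 2) F, A.trace = 0 → B.trace = 0 → Φ₀ A = 0 → Φ₀ B = 0 →
      Φ₀ (A * B - B * A) = 0)
    {J : Matrix (Fin 2) (Fin 2) K} (hJ2 : J * J = -1) (hK : ∀ μ : K, μ * μ ≠ -1)
    (hnoCM : ∀ A : Matrix (Fin 2) (Fin 2) F,
      A.map (algebraMap F K) * J = J * A.map (algebraMap F K) → ∃ q : F, A = q • (1 : Matrix _ _ F))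
    (hJ : Φ J = 0) (Y : Matrix (Fin 2) (Fin 2) K) (hY : Y.trace = 0) : Φ Y = 0 := by
  have hJtr : J.trace = 0 := trace_eq_zero_of_mul_self_eq_neg_one hJ2 hK
  -- (i) no eigenvectors at all
  have hi : ∀ v : Fin 2 → F, v ≠ 0 → ∀ μ : K,
      J.mulVec (fun i => algebraMap F K (v i)) ≠ μ • fun i => algebraMap F K (v i) := by
    intro v₀ hv₀ μ hμ
    set v : Fin 2 → K := fun i => algebraMap F K (v₀ i) with hv
    have hv0 : v ≠ 0 := by
      intro h
      apply hv₀
      funext i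
      have hi' : algebraMap F K (v₀ i) = 0 := by simpa [hv] using congrFun h i
      exact (algebraMap F K).injective (by rw [hi', Pi.zero_apply, map_zero])
    have h1 : (J * J).mulVec v = (μ * μ) • v := by
      rw [← Matrix.mulVec_mulVec, hμ, Matrix.mulVec_smul, hμ, smul_smul]
    rw [hJ2, Matrix.neg_mulVec, Matrix.one_mulVec] at h1
    have h2 : (μ * μ + 1) • v = 0 := by rw [add_smul, one_smul, ← h1, neg_add_cancel]
    rcases smul_eq_zero.1 h2 with h | h
    · exact hK μ (by linear_combination h)
    · exact hv0 h
  -- (ii) not a multiple of a rational matrix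
  have hii : ∀ (A : Matrix (Fin 2) (Fin 2) F) (μ : K), J ≠ μ • A.map (algebraMap F K) := by
    intro A μ hJA
    have hcomm : A.map (algebraMap F K) * J = J * A.map (algebraMap F K) := by
      rw [hJA, Matrix.mul_smul, Matrix.smul_mul]
    obtain ⟨q, rfl⟩ := hnoCM A hcomm
    have hmap1 : (q • (1 : Matrix (Fin 2) (Fin 2) F)).map (algebraMap F K) =
        algebraMap F K q • (1 : Matrix (Fin 2) (Fin 2) K) := by
      ext i j
      rw [Matrix.map_apply, Matrix.smul_apply, Matrix.smul_apply, smul_eq_mul, smul_eq_mul,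
        Matrix.one_apply, Matrix.one_apply]
      split_ifs <;> simp
    have hJs : J = (μ * algebraMap F K q) • (1 : Matrix (Fin 2) (Fin 2) K) := by
      rw [hJA, hmap1, smul_smul]
    apply hK (μ * algebraMap F K q)
    have := congrFun (congrFun hJ2 0) 0
    rw [hJs, Matrix.smul_mul, Matrix.one_mul, Matrix.smul_apply, Matrix.smul_apply,
      Matrix.one_apply_eq, Matrix.neg_apply, Matrix.one_apply_eq, smul_eq_mul, smul_eq_mul,
      mul_one] at this
    exact this
  exact sl2_annihilator_of_noRationalEigenline Φ₀ Φ hΦ hlie hJtr hJ hi hii Y hY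

end ComplexStructure

end Literature.RepresentationTheory.GeneralLinear
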